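import Summits.KontsevichZagierPeriods.KontsevichZagierPeriods.Theorems.TorsionLogsOneThirdPeriod
import Summits.KontsevichZagierPeriods.KontsevichZagierPeriods.Theorems.TorsionLogsGKZLevelThreePairBetaCubic
import HarnessLib

/-!
# `BetaLinearSector` (stmt-KontsevichZagierPeriods-3897), line `fermat-sector-transport` —
# stub `stub_isogenyThree_piece_pos` (the real 3-isogeny `y² = x³ + 1 → Y² = X³ − 1`, arc `(2, ∞)`)

The LEVEL-6 rung of the crux `BetaLinearSector` (route FermatIsogeny) realises the coincidence
`B(1/6,1/2) = √3·B(1/3,1/2)` INSIDE the Kontsevich–Zagier calculus, through the REAL 3-ISOGENY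
`ψ : y² = x³ + 1 → Y² = X³ − 1` with `ℚ`-rational `x`-map
`X(x) = (x³ + 4)/(3x²)`, `X′(x) = (x³ − 8)/(3x³)`, `ψ^*(dX/Y) = √3·dx/y`.
The key identity is `(x³ + 4)³ − 27x⁶ = (x³ + 1)(x³ − 8)²`, i.e.
`X³ − 1 = ((x³ + 1)/3)·((x³ − 8)/(3x³))²`.

This file is the UNBOUNDED arc `(2, ∞)`: there `x³ − 8 > 0`, so `X′ > 0`, `X(2) = 1`, `X → ∞`,
and `X` maps `(2, ∞)` bijectively onto `(1, ∞)`; the Jacobian identity is exact,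
`(1/√(X³ − 1))·|X′| = √3/√(x³ + 1)`.  Hence for `S = [(2,∞), √3/√(x³+1)]` and
`T = [(1,∞), 1/√(x³−1)]` (integrands prescribed on the domains only), `[S] − [T]` is ONE
change-of-variables move (rule (2)), packaged by the one-dimensional
`of_sub_of_mem_changeOfVariablesRel_dimOne`.

## References

* M. Kontsevich, D. Zagier, *Periods* (2001), §1.2 rule (2).
* J. H. Silverman, *The Arithmetic of Elliptic Curves* (2009), III.4 (isogenies), III.6.
-/

noncomputable section

namespace Summit.KontsevichZagierPeriods.FermatIsogeny.BetaLinearSector.Sixths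

open Set MeasureTheory
open MvPolynomial (aeval X C)
open Literature.NumberTheory.Transcendental Literature.NumberTheory.Transcendental.KZ
open Literature.ModelTheory.ExponentialFields (IsSemialgebraic)
open Summit.KontsevichZagierPeriods.HermiteRigidity.CMTwistQuasiPeriodTransfer
  (of_sub_of_mem_changeOfVariablesRel_dimOne image_fin_one)
open Summit.KontsevichZagierPeriods.KontsevichZagierPeriods.Theorems.GKZLevelThree
  (isSemialgebraicFunOn_ratFun₁)

/-! ## Real algebra of the 3-isogeny `x`-map `X(x) = (x³ + 4)/(3x²)` -/

/-- **The 3-isogeny identity** `(x³ + 4)³ − 27x⁶ = (x³ + 1)(x³ − 8)²`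
(`Y² = X³ − 1` pulled back along `X = (x³+4)/(3x²)`). [folklore] -/
theorem isoPos_isogeny_identity (x : ℝ) :
    (x ^ 3 + 4) ^ 3 - 27 * x ^ 6 = (x ^ 3 + 1) * (x ^ 3 - 8) ^ 2 := by
  ring

/-- `X(x)³ − 1 = ((x³ + 1)/3)·((x³ − 8)/(3x³))²` for `x ≠ 0`. [folklore] -/
theorem isoPos_xMap_cube_sub_one {x : ℝ} (hx : x ≠ 0) :
    ((x ^ 3 + 4) / (3 * x ^ 2)) ^ 3 - 1 = (x ^ 3 + 1) / 3 * ((x ^ 3 - 8) / (3 * x ^ 3)) ^ 2 := by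
  field_simp
  ring

/-- For `2 < x`, `X(x) = (x³ + 4)/(3x²) > 1` (`x³ − 3x² + 4 = (x + 1)(x − 2)² > 0`). [folklore] -/
theorem isoPos_one_lt_xMap {x : ℝ} (hx : 2 < x) : 1 < (x ^ 3 + 4) / (3 * x ^ 2) := by
  have hx0 : (0:ℝ) < x := by linarith
  rw [lt_div_iff₀ (by positivity)]
  nlinarith [mul_pos (mul_pos (by linarith : (0:ℝ) < x - 2) (by linarith : (0:ℝ) < x - 2))
    (by linarith : (0:ℝ) < x + 1)]

/-- `X` is injective on `(2, ∞)`: `X a = X b` forces `(a − b)(a²b² − 4(a + b)) = 0`, and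
`a²b² − 4(a + b) > 0` there. [folklore] -/
theorem isoPos_xMap_injective {a b : ℝ} (ha : 2 < a) (hb : 2 < b)
    (h : (a ^ 3 + 4) / (3 * a ^ 2) = (b ^ 3 + 4) / (3 * b ^ 2)) : a = b := by
  have ha0 : (0:ℝ) < a := by linarith
  have hb0 : (0:ℝ) < b := by linarith
  rw [div_eq_div_iff (by positivity) (by positivity)] at h
  have key : (a - b) * (a ^ 2 * b ^ 2 - 4 * (a + b)) = 0 := by
    linear_combination (1 / 3 : ℝ) * h
  have h1 : 0 < (a - 2) * (b - 2) := mul_pos (by linarith) (by linarith)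
  have h2 : 0 < (a * b - 4) * (a * b) := mul_pos (by nlinarith) (mul_pos ha0 hb0)
  have hK : 0 < a ^ 2 * b ^ 2 - 4 * (a + b) := by nlinarith
  rcases mul_eq_zero.mp key with h0 | h0
  · linarith
  · exact absurd h0 hK.ne'

/-- `X` has derivative `(x³ − 8)/(3x³)` at every `x ≠ 0`. [folklore] -/
theorem isoPos_hasDerivAt_xMap {x : ℝ} (hx : x ≠ 0) :
    HasDerivAt (fun y : ℝ => (y ^ 3 + 4) / (3 * y ^ 2)) ((x ^ 3 - 8) / (3 * x ^ 3)) x := by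
  have hnum : HasDerivAt (fun y : ℝ => y ^ 3 + 4) (3 * x ^ 2) x := by
    have h := (hasDerivAt_pow 3 x).add_const (4 : ℝ)
    exact h.congr_deriv (by norm_num)
  have hden : HasDerivAt (fun y : ℝ => 3 * y ^ 2) (3 * (2 * x)) x := by
    have h := (hasDerivAt_pow 2 x).const_mul (3 : ℝ)
    exact h.congr_deriv (by norm_num)
  have h3 : 3 * x ^ 2 ≠ 0 := by positivity
  refine (hnum.div hden h3).congr_deriv ?_
  rw [div_eq_div_iff (pow_ne_zero 2 h3) (by positivity)]
  ring

/-- **Surjectivity onto `(1, ∞)`**: every `c > 1` is `X x` for some `x > 2` (intermediate value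
theorem on `[2, 3c]`: `X 2 = 1 < c ≤ X (3c)` since `X x ≥ x/3`). [folklore] -/
theorem isoPos_exists_xMap_eq {c : ℝ} (hc : 1 < c) :
    ∃ x : ℝ, 2 < x ∧ (x ^ 3 + 4) / (3 * x ^ 2) = c := by
  set f : ℝ → ℝ := fun y => (y ^ 3 + 4) / (3 * y ^ 2) with hf
  have h2c : (2:ℝ) ≤ 3 * c := by linarith
  have hcont : ContinuousOn f (Icc 2 (3 * c)) := fun y hy =>
    (isoPos_hasDerivAt_xMap (by linarith [hy.1] : (0:ℝ) < y).ne').continuousAt.continuousWithinAt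
  have hf2 : f 2 = 1 := by rw [hf]; norm_num
  have hfa : f 2 ≤ c := by rw [hf2]; exact hc.le
  have hfb : c ≤ f (3 * c) := by
    show c ≤ ((3 * c) ^ 3 + 4) / (3 * (3 * c) ^ 2)
    rw [le_div_iff₀ (by positivity)]
    nlinarith
  obtain ⟨x, hx, hxc⟩ := intermediate_value_Icc h2c hcont ⟨hfa, hfb⟩
  refine ⟨x, ?_, hxc⟩
  rcases hx.1.lt_or_eq with h | h
  · exact h
  · exfalso
    rw [← h, hf2] at hxc
    linarith

/-- The image of `(2, ∞)` under `X` is `(1, ∞)`. [folklore] -/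
theorem isoPos_image_xMap :
    (fun x : ℝ => (x ^ 3 + 4) / (3 * x ^ 2)) '' Ioi 2 = Ioi 1 := by
  ext c
  constructor
  · rintro ⟨x, hx, rfl⟩
    exact isoPos_one_lt_xMap hx
  · intro hc
    obtain ⟨x, hx, hxc⟩ := isoPos_exists_xMap_eq (c := c) hc
    exact ⟨x, hx, hxc⟩

/-- **The rule-2 integrand identity** on `(2, ∞)`:
`√3/√(x³ + 1) = (1/√(X(x)³ − 1))·|(x³ − 8)/(3x³)|` (`ψ^*(dX/Y) = √3·dx/y`).
[cite: KontsevichZagier2001, §1.2 rule (2)] -/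
theorem isoPos_jacobian {x : ℝ} (hx : 2 < x) :
    Real.sqrt 3 / Real.sqrt (x ^ 3 + 1) =
      1 / Real.sqrt (((x ^ 3 + 4) / (3 * x ^ 2)) ^ 3 - 1) * |(x ^ 3 - 8) / (3 * x ^ 3)| := by
  have hx0 : (0:ℝ) < x := by linarith
  have h8 : 0 < x ^ 3 - 8 := by
    nlinarith [mul_pos (mul_pos (by linarith : (0:ℝ) < x - 2) hx0) hx0]
  have h1 : 0 < x ^ 3 + 1 := by positivity
  have hk : 0 < (x ^ 3 - 8) / (3 * x ^ 3) := by positivity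
  rw [isoPos_xMap_cube_sub_one hx0.ne', Real.sqrt_mul (by positivity : (0:ℝ) ≤ (x ^ 3 + 1) / 3),
    Real.sqrt_sq_eq_abs, abs_of_pos hk, Real.sqrt_div' _ (by norm_num : (0:ℝ) ≤ 3)]
  have hs3 : 0 < Real.sqrt 3 := Real.sqrt_pos.2 three_pos
  have hs1 : 0 < Real.sqrt (x ^ 3 + 1) := Real.sqrt_pos.2 h1
  field_simp

/-! ## The arc `(2, ∞)`: `S ∼ T` by ONE change of variables -/

/-- **The 3-isogeny chain on the arc `(2, ∞)`.** For any representations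
`S = [(2,∞), √3/√(x³+1)]` and `T = [(1,∞), 1/√(x³−1)]` (integrands prescribed on the domains only),
`KZ.Equivalent S T`: ONE change of variables (rule (2)) along the `x`-map
`X(x) = (x³+4)/(3x²)` of the real 3-isogeny `y² = x³ + 1 → Y² = X³ − 1` (a `ℚ`-rational function,
pole-free, injective and with derivative `(x³−8)/(3x³) > 0` on `(2,∞)`, image `(1,∞)`), with the
exact Jacobian identity `(1/√(X³−1))·|X′| = √3/√(x³+1)` (`isoPos_jacobian`).
[cite: KontsevichZagier2001, §1.2 rule (2)] -/
theorem stub_isogenyThree_piece_pos : ∀ (S T : KZ.IntegralRep 1), S.domain = {x | 2 < x 0} → Set.EqOn S.integrand (fun x => Real.sqrt 3 / Real.sqrt (x 0 ^ 3 + 1)) S.domain → T.domain = {x | 1 < x 0} → Set.EqOn T.integrand (fun x => 1 / Real.sqrt (x 0 ^ 3 - 1)) T.domain → KZ.Equivalent S T := by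
  intro S T hSd hSi hTd hTi
  set φ : ℝ → ℝ := fun y => (y ^ 3 + 4) / (3 * y ^ 2) with hφ
  set φ' : ℝ → ℝ := fun y => (y ^ 3 - 8) / (3 * y ^ 3) with hφ'
  have hmem : ∀ p ∈ S.domain, 2 < p 0 := fun p hp => by rw [hSd] at hp; exact hp
  refine changeOfVariablesRel_subset_relations
    (of_sub_of_mem_changeOfVariablesRel_dimOne S T φ φ' ?_ ?_ ?_ ?_ ?_)
  · -- semialgebraic: a `ℚ`-rational function of `p 0`, pole-free on `(2, ∞)`
    refine isSemialgebraicFunOn_ratFun₁ S.isSemialgebraic_domain (X 0 ^ 3 + 4) (3 * X 0 ^ 2) φ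
      (fun p hp => ?_) (fun p _ => ?_)
    · have h0 : (0:ℝ) < p 0 := by linarith [hmem p hp]
      simp only [map_mul, map_pow, MvPolynomial.aeval_X, map_ofNat]
      positivity
    · simp only [hφ, map_mul, map_add, map_pow, MvPolynomial.aeval_X, map_ofNat]
  · -- derivative
    intro p hp
    have h0 : (0:ℝ) < p 0 := by linarith [hmem p hp]
    exact isoPos_hasDerivAt_xMap h0.ne'
  · -- injective
    intro p hp q hq h
    exact isoPos_xMap_injective (hmem p hp) (hmem q hq) h
  · -- image
    rw [hTd, hSd]
    exact (image_fin_one isoPos_image_xMap).symm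
  · -- integrands
    intro p hp
    have hp' := hmem p hp
    have hφp : (fun _ : Fin 1 => φ (p 0)) ∈ T.domain := by
      rw [hTd]
      exact isoPos_one_lt_xMap hp'
    rw [hSi hp, hTi hφp]
    exact isoPos_jacobian hp'

end Summit.KontsevichZagierPeriods.FermatIsogeny.BetaLinearSector.Sixths

end
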